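import Literature.AlgebraicGeometry.HodgeTheory.KunnethStandardConjectureSurjections
import Literature.AlgebraicGeometry.HodgeTheory.KunnethComponentsDiagonalTranspose
import Literature.AlgebraicGeometry.HodgeTheory.CorrespondenceTranspose
import HarnessLib

/-!
# The Künneth components of a graph class: under `C(X)` the graded pieces of `g_*` and `g^*` are
# algebraic correspondences

Family `hodge`, layer `Literature/AlgebraicGeometry/HodgeTheory`; namespace
`Literature.AlgebraicGeometry.HodgeTheory`. Theorems only (no definition, no named fact, sorry-free).

For a morphism `g : X ⟶ W` of smooth projective complex varieties (`dim X = n`, `dim W = m`) the graph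
class `[Γ_g] = (g, 𝟙)_* 1 ∈ H^{2m}((W ⊗ X)(ℂ); ℂ)` acts as `g_*` and its transpose
`[ᵗΓ_g] = (𝟙, g)_* 1 ∈ H^{2m}((X ⊗ W)(ℂ); ℂ)` as `g^*` (the tree's `corrAction_graph_one`,
`corrAction_transposeGraph_one`; Fulton Def. 16.1.2, Kahn Ex. 3.47). Composing with a Künneth
decomposition `cl(Δ_X) = Σ_d π_X d` of the diagonal of `X` — `Γ_g = Γ_g ∘ Δ_X = Σ_d Γ_g ∘ π_X d`, and
`Γ_g ∘ γ = (g × 1)_* γ` (Fulton Prop. 16.1.1 (c) (i)) — exhibits the Künneth components of `[Γ_g]`: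

* §1 `complexGysin_whiskerRight_diagonalClass` — `(g ▷ X)_* cl(Δ_X) = [Γ_g]`;
  `complexGysin_whiskerRight_mem_kunnethPiece` — `(g ▷ X)_*` maps `H^{2n−d}(X) ⊗ Hᵈ(X)` into
  `H^{2m−d}(W) ⊗ Hᵈ(X)` (`d ≤ 2m ≤ 2n`), and `complexGysin_whiskerRight_eq_zero_of_lt` — it kills
  `H^{2n−d}(X) ⊗ Hᵈ(X)` for `d > 2m` (such a class would act `Hᵃ(X) → Hᵇ(W)` only for `a = 2n − d`,
  `b = 2m − d < 0`); the actions `corrAction_complexGysin_whiskerRight_kunnethComponent_of_add_eq/_ne`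
  — `((g ▷ X)_* π_X d)_*` is `g_*` on `H^{2n−d}(X(ℂ))` and zero in every other degree: THE GRADED
  PIECES OF `g_*`.
* §2 **`kunnethComponents_graphClass`** — for `dim W ≤ dim X`, the classes `(g ▷ X)_* π_X d`,
  `d = 0, …, 2m`, form a Künneth decomposition of `[Γ_g]`; by uniqueness of Künneth decompositions
  (`eq_of_sum_kunnethPiece_eq`) every Künneth decomposition of `[Γ_g]` is this one
  (`kunnethComponent_graphClass_eq`), so **`kunnethComponent_graphClass_mem_algebraicClasses`** —
  **under `C(X)` every Künneth component of `[Γ_g]` is algebraic** (Gysin images of algebraic classes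
  are algebraic), family-free form `…_of_forall`.
* §3 **`kunnethComponent_transposeGraphClass_mem_algebraicClasses`** — the same for the transposed
  graph `[ᵗΓ_g] ∈ H^{2m}((X ⊗ W)(ℂ))` (the graded pieces of `g^*`): transport along the exchange of
  factors `σ`, `σ^*[Γ_g] = [ᵗΓ_g]` (the tree's `complexBetti_map_swap_complexGysin_lift_one`), which maps
  Künneth pieces to Künneth pieces (`map_swap_mem_kunnethPiece`) and preserves algebraicity
  (`mem_algebraicClasses_map_iff_of_iso`).

(Kahn, Def. 6.29 and the identities of Lemma 6.30: once the `p^i_X` are algebraic, `h(X) = ⊕ hⁱ(X)`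
and every morphism of motives `h(X) → h(W)` induced by a graph decomposes into its graded pieces
`p^i_W ∘ Γ_g ∘ p^i_X = Γ_g ∘ p^i_X`.)

## References

* [Fulton1998] W. Fulton, Intersection Theory, 2nd ed., Springer 1998, §16.1 Def. 16.1.1,
  Prop. 16.1.1 (b)–(c), Def. 16.1.2.
* [Kahn2020] B. Kahn, Zeta and L-functions of varieties and motives, LMS LN 462, CUP 2020, §3.5.3
  Example 3.47, Lemma 3.48; §6.9 Def. 6.29, Lemma 6.30.
* [VoisinHodgeI2002] C. Voisin, Hodge Theory and Complex Algebraic Geometry I, CUP 2002, §11.3.3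
  pp. 286–287.
* [Voisin2025] C. Voisin, Hodge and generalized Hodge conjectures, coniveau and algebraic cycles,
  J. Open Math. Probl. 1 (2025), §3.2.1 (12)–(14).
-/

noncomputable section

open CategoryTheory AlgebraicGeometry MonoidalCategory CartesianMonoidalCategory Finset
open Literature.AlgebraicTopology.SingularHomology
open Literature.AlgebraicGeometry.Motives (IsSmoothProjective ComplexPoints)

namespace Literature.AlgebraicGeometry.HodgeTheory

variable {n m : ℕ} {X W : Motives.SchemeOver ℂ}

/-! ### §1 Pushing the diagonal and its Künneth pieces forward along `g ▷ X` -/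

/-- **`(g ▷ X)_* cl(Δ_X) = [Γ_g] = (g, 𝟙)_* 1`** (complex orientations): `Δ_X ≫ (g ▷ X) = (g, 𝟙)` and
functoriality of the Gysin morphisms. [cite: Fulton1998, §16.1 Prop. 16.1.1 (c)]
[cite: Kahn2020, §3.5.3 Example 3.47] -/
theorem complexGysin_whiskerRight_diagonalClass (hX : IsSmoothProjective n X) (hW : IsSmoothProjective m W)
    (g : X ⟶ W) :
    complexGysin complexOrientationFamily (Motives.IsSmoothProjective.tensor_holds hX hX)
        (Motives.IsSmoothProjective.tensor_holds hW hX) (g ▷ X)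
        (show 2 * n + 2 * (m + n) = 2 * m + 2 * (n + n) by omega) (diagonalClass hX) =
      complexGysin complexOrientationFamily hX (Motives.IsSmoothProjective.tensor_holds hW hX)
        (lift g (𝟙 X)) (show 0 + 2 * (m + n) = 2 * m + 2 * n by omega)
        (singularCohomology.one ℂ (ComplexPoints X)) := by
  have hμ : complexOrientationFamily.HasPoincareDuality := hasPoincareDuality_complexOrientationFamily
  rw [diagonalClass, ← LinearMap.comp_apply,
    ← complexGysin_comp hμ hX (Motives.IsSmoothProjective.tensor_holds hX hX)
      (Motives.IsSmoothProjective.tensor_holds hW hX) (lift (𝟙 X) (𝟙 X)) (g ▷ X)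
      (show 0 + 2 * (n + n) = 2 * n + 2 * n by omega)
      (show 2 * n + 2 * (m + n) = 2 * m + 2 * (n + n) by omega)]
  have hdiag : lift (𝟙 X) (𝟙 X) ≫ (g ▷ X) = lift g (𝟙 X) := by ext <;> simp
  simp only [hdiag]

/-- **`(g ▷ X)_* (H^{2n−d}(X) ⊗ Hᵈ(X)) ⊆ H^{2m−d}(W) ⊗ Hᵈ(X)`** for `g : X ⟶ W`, `dim W = m ≤ n = dim X`
(any orientation family): the case `g₁ = g`, `g₂ = 𝟙` of `complexGysin_tensorHom_mem_kunnethPiece`.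
[cite: VoisinHodgeI2002, §11.3.3 p. 286] [cite: Fulton1998, §16.1 Prop. 16.1.1 (c)] -/
theorem complexGysin_whiskerRight_mem_kunnethPiece (μ : OrientationFamily) (hX : IsSmoothProjective n X)
    (hW : IsSmoothProjective m W) (g : X ⟶ W) (hmn : m ≤ n) {i j j' : ℕ} (hji : j + i = 2 * n)
    (hji' : j' + i = 2 * m) {z : complexBetti (X ⊗ X) (2 * n)} (hz : z ∈ kunnethPiece X X hji) :
    complexGysin μ (Motives.IsSmoothProjective.tensor_holds hX hX)
        (Motives.IsSmoothProjective.tensor_holds hW hX) (g ▷ X)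
        (show 2 * n + 2 * (m + n) = 2 * m + 2 * (n + n) by omega) z ∈ kunnethPiece W X hji' := by
  have h := complexGysin_tensorHom_mem_kunnethPiece μ hX hX hW hX g (𝟙 X) (e' := n) (e₁ := n) (e := m)
    rfl (show 2 * n + 2 * (m + n) = 2 * m + 2 * (n + n) by omega) hmn hji hji' rfl hz
  simpa only [tensorHom_id] using h

/-- **`(g ▷ X)_*` kills the Künneth piece `H^{2n−d}(X) ⊗ Hᵈ(X)` for `d > 2 dim W`** (any orientation
family): the push-forward acts as `g_* ∘ z_*` (`corrAction_complexGysin_whiskerRight`), `z` acts only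
on `H^{2n−d}(X(ℂ))`, and `g_* : H^{2n−d}(X) → H^{2m−d}(W)` has no target in degree `2m − d < 0` — in
the tree's typing: for every action degree `a + 2m = b + 2n` one has `a ≥ 2n − 2m > 2n − d`, so the
class acts as zero everywhere and vanishes by faithfulness (`eq_zero_of_forall_corrAction_eq_zero`).
[cite: VoisinHodgeI2002, §11.3.3 p. 286] [cite: Voisin2025, §3.2.1 (12)–(13)] -/
theorem complexGysin_whiskerRight_eq_zero_of_lt (μ : OrientationFamily) (hX : IsSmoothProjective n X)
    (hW : IsSmoothProjective m W) (g : X ⟶ W) {i j : ℕ} (hji : j + i = 2 * n) (hi : 2 * m < i)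
    {z : complexBetti (X ⊗ X) (2 * n)} (hz : z ∈ kunnethPiece X X hji) :
    complexGysin μ (Motives.IsSmoothProjective.tensor_holds hX hX)
        (Motives.IsSmoothProjective.tensor_holds hW hX) (g ▷ X)
        (show 2 * n + 2 * (m + n) = 2 * m + 2 * (n + n) by omega) z = 0 := by
  refine eq_zero_of_forall_corrAction_eq_zero μ hW hX fun a b hab ↦ ?_
  ext c
  rw [LinearMap.zero_apply,
    corrAction_complexGysin_whiskerRight μ hX hW hX g (rfl : a + 2 * n = a + 2 * n) hab
      (show 2 * n + 2 * (m + n) = 2 * m + 2 * (n + n) by omega) hab z c,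
    corrAction_eq_zero_of_mem_kunnethPiece_of_ne μ hX hX hji hz rfl (by omega),
    LinearMap.zero_apply, map_zero]

section Family

variable {π : Fin (2 * n + 1) → complexBetti (X ⊗ X) (2 * n)}

/-- **`((g ▷ X)_* π_X d)_* = g_*` on `H^{2n−d}(X(ℂ); ℂ)`** (complex orientations), for every Künneth
decomposition `cl(Δ_X) = Σ π_X d`: `((g ▷ X)_* π)_* = g_* ∘ π_*` and `π_X d` acts as the identity on
`H^{2n−d}` — the graded piece of `g_*` in degree `2n − d`. [cite: Fulton1998, §16.1 Prop. 16.1.1 (c)]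
[cite: Voisin2025, §3.2.1 (14)] -/
theorem corrAction_complexGysin_whiskerRight_kunnethComponent_of_add_eq (hX : IsSmoothProjective n X)
    (hW : IsSmoothProjective m W) (g : X ⟶ W)
    (hπ : ∀ i : Fin (2 * n + 1), π i ∈ kunnethPiece X X (show (2 * n - (i : ℕ)) + i = 2 * n by omega))
    (hΔ : ∑ i, π i = diagonalClass hX) (d : Fin (2 * n + 1)) {a b : ℕ} (hab : a + 2 * m = b + 2 * n)
    (ha : a + d = 2 * n) :
    corrAction complexOrientationFamily hW hX hab
        (complexGysin complexOrientationFamily (Motives.IsSmoothProjective.tensor_holds hX hX)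
          (Motives.IsSmoothProjective.tensor_holds hW hX) (g ▷ X)
          (show 2 * n + 2 * (m + n) = 2 * m + 2 * (n + n) by omega) (π d)) =
      complexGysin complexOrientationFamily hX hW g hab := by
  ext c
  rw [corrAction_complexGysin_whiskerRight complexOrientationFamily hX hW hX g
      (rfl : a + 2 * n = a + 2 * n) hab (show 2 * n + 2 * (m + n) = 2 * m + 2 * (n + n) by omega) hab
      (π d) c,
    corrAction_kunnethComponent_diagonalClass_apply_of_add_eq hX hπ hΔ d rfl ha]

/-- **`((g ▷ X)_* π_X d)_* = 0` on `Hᵃ(X(ℂ); ℂ)` for `a ≠ 2n − d`** (any orientation family, any Künneth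
family `π_X`). [cite: Fulton1998, §16.1 Prop. 16.1.1 (c)] [cite: Voisin2025, §3.2.1 (14)] -/
theorem corrAction_complexGysin_whiskerRight_kunnethComponent_of_add_ne (μ : OrientationFamily)
    (hX : IsSmoothProjective n X) (hW : IsSmoothProjective m W) (g : X ⟶ W)
    (hπ : ∀ i : Fin (2 * n + 1), π i ∈ kunnethPiece X X (show (2 * n - (i : ℕ)) + i = 2 * n by omega))
    (d : Fin (2 * n + 1)) {a b : ℕ} (hab : a + 2 * m = b + 2 * n) (ha : a + d ≠ 2 * n) :
    corrAction μ hW hX hab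
        (complexGysin μ (Motives.IsSmoothProjective.tensor_holds hX hX)
          (Motives.IsSmoothProjective.tensor_holds hW hX) (g ▷ X)
          (show 2 * n + 2 * (m + n) = 2 * m + 2 * (n + n) by omega) (π d)) = 0 := by
  ext c
  rw [LinearMap.zero_apply,
    corrAction_complexGysin_whiskerRight μ hX hW hX g (rfl : a + 2 * n = a + 2 * n) hab
      (show 2 * n + 2 * (m + n) = 2 * m + 2 * (n + n) by omega) hab (π d) c,
    corrAction_kunnethComponent_diagonalClass_of_add_ne μ hX hπ d rfl ha, LinearMap.zero_apply, map_zero]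

/-! ### §2 The Künneth decomposition of `[Γ_g]`; algebraicity under `C(X)` -/

/-- **The Künneth decomposition of the graph class.** For `g : X ⟶ W` with `dim W = m ≤ n = dim X` and a
Künneth decomposition `cl(Δ_X) = Σ_{d ≤ 2n} π_X d`, the classes `(g ▷ X)_* π_X d`, `d = 0, …, 2m`, lie
in the Künneth pieces `H^{2m−d}(W) ⊗ Hᵈ(X)` and sum to `[Γ_g] = (g, 𝟙)_* 1` (the summands with
`d > 2m` vanish, §1). [cite: Fulton1998, §16.1 Prop. 16.1.1 (c)] [cite: Kahn2020, §6.9 Def. 6.29 and Lemma 6.30]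
[cite: Voisin2025, §3.2.1 (14)] -/
theorem kunnethComponents_graphClass (hX : IsSmoothProjective n X) (hW : IsSmoothProjective m W)
    (g : X ⟶ W) (hmn : m ≤ n)
    (hπ : ∀ i : Fin (2 * n + 1), π i ∈ kunnethPiece X X (show (2 * n - (i : ℕ)) + i = 2 * n by omega))
    (hΔ : ∑ i, π i = diagonalClass hX) :
    (∀ d : Fin (2 * m + 1),
        complexGysin complexOrientationFamily (Motives.IsSmoothProjective.tensor_holds hX hX)
            (Motives.IsSmoothProjective.tensor_holds hW hX) (g ▷ X)
            (show 2 * n + 2 * (m + n) = 2 * m + 2 * (n + n) by omega)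
            (π (Fin.castLE (by omega) d)) ∈
          kunnethPiece W X (show (2 * m - (d : ℕ)) + d = 2 * m by omega)) ∧
      ∑ d : Fin (2 * m + 1),
          complexGysin complexOrientationFamily (Motives.IsSmoothProjective.tensor_holds hX hX)
            (Motives.IsSmoothProjective.tensor_holds hW hX) (g ▷ X)
            (show 2 * n + 2 * (m + n) = 2 * m + 2 * (n + n) by omega)
            (π (Fin.castLE (by omega) d)) =
        complexGysin complexOrientationFamily hX (Motives.IsSmoothProjective.tensor_holds hW hX)
          (lift g (𝟙 X)) (show 0 + 2 * (m + n) = 2 * m + 2 * n by omega)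
          (singularCohomology.one ℂ (ComplexPoints X)) := by
  have hXX := Motives.IsSmoothProjective.tensor_holds hX hX
  have hWX := Motives.IsSmoothProjective.tensor_holds hW hX
  have hle : 2 * m + 1 ≤ 2 * n + 1 := by omega
  refine ⟨fun d ↦ ?_, ?_⟩
  · have hd := d.isLt
    exact complexGysin_whiskerRight_mem_kunnethPiece complexOrientationFamily hX hW g hmn
      (i := (d : ℕ)) (j := 2 * n - d) (j' := 2 * m - d) (by omega) (by omega)
      (hπ (Fin.castLE hle d))
  -- the push-forwards of the whole family; the members of index `> 2m` vanish
  set F : Fin (2 * n + 1) → complexBetti (W ⊗ X) (2 * m) := fun d' ↦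
    complexGysin complexOrientationFamily hXX hWX (g ▷ X)
      (show 2 * n + 2 * (m + n) = 2 * m + 2 * (n + n) by omega) (π d') with hF
  have hvan : ∀ d' ∈ (Finset.univ : Finset (Fin (2 * n + 1))),
      d' ∉ (Finset.univ : Finset (Fin (2 * m + 1))).map (Fin.castLEEmb hle) → F d' = 0 := by
    intro d' _ hd'
    have hlt : 2 * m < (d' : ℕ) := by
      by_contra h
      exact hd' (Finset.mem_map.2 ⟨⟨d', by omega⟩, Finset.mem_univ _, Fin.ext rfl⟩)
    exact complexGysin_whiskerRight_eq_zero_of_lt complexOrientationFamily hX hW g _ hlt (hπ d')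
  calc ∑ d : Fin (2 * m + 1), complexGysin complexOrientationFamily hXX hWX (g ▷ X)
          (show 2 * n + 2 * (m + n) = 2 * m + 2 * (n + n) by omega) (π (Fin.castLE hle d))
      = ∑ d : Fin (2 * m + 1), F (Fin.castLEEmb hle d) := by simp only [hF, Fin.castLEEmb_apply]
    _ = ∑ d' ∈ (Finset.univ : Finset (Fin (2 * m + 1))).map (Fin.castLEEmb hle), F d' :=
        (Finset.sum_map _ _ _).symm
    _ = ∑ d' : Fin (2 * n + 1), F d' := Finset.sum_subset (Finset.subset_univ _) hvan
    _ = complexGysin complexOrientationFamily hXX hWX (g ▷ X)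
          (show 2 * n + 2 * (m + n) = 2 * m + 2 * (n + n) by omega) (∑ d', π d') := by
        rw [map_sum]
    _ = complexGysin complexOrientationFamily hX hWX (lift g (𝟙 X))
          (show 0 + 2 * (m + n) = 2 * m + 2 * n by omega) (singularCohomology.one ℂ (ComplexPoints X)) := by
        rw [hΔ, complexGysin_whiskerRight_diagonalClass hX hW g]

variable {ρ : Fin (2 * m + 1) → complexBetti (W ⊗ X) (2 * m)}

/-- **Every Künneth decomposition of `[Γ_g]` is `(g ▷ X)_* π_X`** (`dim W ≤ dim X`): uniqueness of
Künneth decompositions (`eq_of_sum_kunnethPiece_eq`). [cite: Fulton1998, §16.1 Prop. 16.1.1 (c)]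
[cite: VoisinHodgeI2002, §11.3.3 p. 286] -/
theorem kunnethComponent_graphClass_eq (hX : IsSmoothProjective n X) (hW : IsSmoothProjective m W)
    (g : X ⟶ W) (hmn : m ≤ n)
    (hπ : ∀ i : Fin (2 * n + 1), π i ∈ kunnethPiece X X (show (2 * n - (i : ℕ)) + i = 2 * n by omega))
    (hΔ : ∑ i, π i = diagonalClass hX)
    (hρ : ∀ d : Fin (2 * m + 1), ρ d ∈ kunnethPiece W X (show (2 * m - (d : ℕ)) + d = 2 * m by omega))
    (hΓ : ∑ d, ρ d =
      complexGysin complexOrientationFamily hX (Motives.IsSmoothProjective.tensor_holds hW hX)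
        (lift g (𝟙 X)) (show 0 + 2 * (m + n) = 2 * m + 2 * n by omega)
        (singularCohomology.one ℂ (ComplexPoints X)))
    (d : Fin (2 * m + 1)) :
    ρ d = complexGysin complexOrientationFamily (Motives.IsSmoothProjective.tensor_holds hX hX)
        (Motives.IsSmoothProjective.tensor_holds hW hX) (g ▷ X)
        (show 2 * n + 2 * (m + n) = 2 * m + 2 * (n + n) by omega) (π (Fin.castLE (by omega) d)) := by
  obtain ⟨hρ', hΓ'⟩ := kunnethComponents_graphClass hX hW g hmn hπ hΔ
  exact congrFun (eq_of_sum_kunnethPiece_eq hW hX (2 * m) hρ hρ' (hΓ.trans hΓ'.symm)) d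

/-- **Under `C(X)` every Künneth component of the graph class `[Γ_g] ∈ H^{2m}((W ⊗ X)(ℂ); ℂ)` is
algebraic** (`g : X ⟶ W`, `dim W ≤ dim X`): it is `(g ▷ X)_* π_X d` for the given Künneth family `π_X`
with algebraic members, and Gysin morphisms preserve algebraic classes. These are the algebraic
correspondences inducing the graded pieces of `g_*` (§1). [cite: Kahn2020, §6.9 Def. 6.29 and Lemma 6.30]
[cite: Fulton1998, §16.1 Prop. 16.1.1 (c)] [cite: VoisinHodgeII2003, §9.2.4 Prop. 9.21 (ii)] -/
theorem kunnethComponent_graphClass_mem_algebraicClasses (hX : IsSmoothProjective n X)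
    (hW : IsSmoothProjective m W) (g : X ⟶ W) (hmn : m ≤ n)
    (hπ : ∀ i : Fin (2 * n + 1), π i ∈ kunnethPiece X X (show (2 * n - (i : ℕ)) + i = 2 * n by omega))
    (hΔ : ∑ i, π i = diagonalClass hX) (hC : ∀ i, π i ∈ algebraicClasses (X ⊗ X) n)
    (hρ : ∀ d : Fin (2 * m + 1), ρ d ∈ kunnethPiece W X (show (2 * m - (d : ℕ)) + d = 2 * m by omega))
    (hΓ : ∑ d, ρ d =
      complexGysin complexOrientationFamily hX (Motives.IsSmoothProjective.tensor_holds hW hX)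
        (lift g (𝟙 X)) (show 0 + 2 * (m + n) = 2 * m + 2 * n by omega)
        (singularCohomology.one ℂ (ComplexPoints X)))
    (d : Fin (2 * m + 1)) :
    ρ d ∈ algebraicClasses (W ⊗ X) m := by
  rw [kunnethComponent_graphClass_eq hX hW g hmn hπ hΔ hρ hΓ d]
  exact complexGysin_mem_algebraicClasses_of_mem_algebraicClasses complexOrientationFamily
    (Motives.IsSmoothProjective.tensor_holds hX hX) (Motives.IsSmoothProjective.tensor_holds hW hX)
    (g ▷ X) _ (hC _)

end Family

/-- **Under `C(X)` every Künneth component of `[Γ_g]` is algebraic**, family-free form (`g : X ⟶ W`,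
`dim W ≤ dim X`; Künneth families of `cl(Δ_X)` exist, `nonempty_kunnethComponents_diagonalClass`).
[cite: Kahn2020, §6.9 Def. 6.29 and Lemma 6.30] [cite: Fulton1998, §16.1 Prop. 16.1.1 (c)] -/
theorem kunnethComponent_graphClass_mem_algebraicClasses_of_forall (hX : IsSmoothProjective n X)
    (hW : IsSmoothProjective m W) (g : X ⟶ W) (hmn : m ≤ n)
    (hCX : ∀ (πX : Fin (2 * n + 1) → complexBetti (X ⊗ X) (2 * n)),
      (∀ i : Fin (2 * n + 1), πX i ∈ kunnethPiece X X (show (2 * n - (i : ℕ)) + i = 2 * n by omega)) →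
      ∑ i, πX i = diagonalClass hX → ∀ i, πX i ∈ algebraicClasses (X ⊗ X) n)
    {ρ : Fin (2 * m + 1) → complexBetti (W ⊗ X) (2 * m)}
    (hρ : ∀ d : Fin (2 * m + 1), ρ d ∈ kunnethPiece W X (show (2 * m - (d : ℕ)) + d = 2 * m by omega))
    (hΓ : ∑ d, ρ d =
      complexGysin complexOrientationFamily hX (Motives.IsSmoothProjective.tensor_holds hW hX)
        (lift g (𝟙 X)) (show 0 + 2 * (m + n) = 2 * m + 2 * n by omega)
        (singularCohomology.one ℂ (ComplexPoints X)))
    (d : Fin (2 * m + 1)) :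
    ρ d ∈ algebraicClasses (W ⊗ X) m := by
  obtain ⟨⟨πX, hπX, hΔX⟩⟩ := nonempty_kunnethComponents_diagonalClass hX
  exact kunnethComponent_graphClass_mem_algebraicClasses hX hW g hmn hπX hΔX (hCX πX hπX hΔX) hρ hΓ d

/-! ### §3 The transposed graph: the graded pieces of `g^*` -/

/-- **Under `C(X)` every Künneth component of the transposed graph class
`[ᵗΓ_g] = (𝟙, g)_* 1 ∈ H^{2m}((X ⊗ W)(ℂ); ℂ)` is algebraic** (`g : X ⟶ W`, `dim W ≤ dim X`; these are
the correspondences inducing the graded pieces of `g^*`): pulled back along the exchange of factors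
`σ : W ⊗ X ⟶ X ⊗ W` and re-indexed by `d ↦ 2m − d`, a Künneth decomposition of `[ᵗΓ_g]` becomes a
Künneth decomposition of `σ^*[ᵗΓ_g] = [Γ_g]` (`map_swap_mem_kunnethPiece`,
`complexBetti_map_swap_complexGysin_lift_one`), whose members are algebraic (§2); and `σ` is an
isomorphism (`mem_algebraicClasses_map_iff_of_iso`). [cite: Kahn2020, §3.5.3 Lemma 3.48 and §6.9 Lemma 6.30 (4)]
[cite: Fulton1998, §16.1 Prop. 16.1.1 (b)–(c)] -/
theorem kunnethComponent_transposeGraphClass_mem_algebraicClasses (hX : IsSmoothProjective n X)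
    (hW : IsSmoothProjective m W) (g : X ⟶ W) (hmn : m ≤ n)
    (hCX : ∀ (πX : Fin (2 * n + 1) → complexBetti (X ⊗ X) (2 * n)),
      (∀ i : Fin (2 * n + 1), πX i ∈ kunnethPiece X X (show (2 * n - (i : ℕ)) + i = 2 * n by omega)) →
      ∑ i, πX i = diagonalClass hX → ∀ i, πX i ∈ algebraicClasses (X ⊗ X) n)
    {ρ : Fin (2 * m + 1) → complexBetti (X ⊗ W) (2 * m)}
    (hρ : ∀ i : Fin (2 * m + 1), ρ i ∈ kunnethPiece X W (show (2 * m - (i : ℕ)) + i = 2 * m by omega))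
    (hΓ : ∑ i, ρ i =
      complexGysin complexOrientationFamily hX (Motives.IsSmoothProjective.tensor_holds hX hW)
        (lift (𝟙 X) g) (show 0 + 2 * (n + m) = 2 * m + 2 * n by omega)
        (singularCohomology.one ℂ (ComplexPoints X)))
    (i : Fin (2 * m + 1)) :
    ρ i ∈ algebraicClasses (X ⊗ W) m := by
  -- the swapped, re-indexed family `τ d = σ^* ρ (2m − d)` on `W ⊗ X`
  let τ : Fin (2 * m + 1) → complexBetti (W ⊗ X) (2 * m) := fun d ↦
    complexBetti.map (lift (snd W X) (fst W X)) (2 * m) (ρ (Fin.rev d))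
  have hτ : ∀ d : Fin (2 * m + 1), τ d ∈ kunnethPiece W X (show (2 * m - (d : ℕ)) + d = 2 * m by omega) := by
    intro d
    have hd := d.isLt
    have hrev := Fin.val_rev d
    exact map_swap_mem_kunnethPiece (hρ (Fin.rev d)) _ (by omega) (by omega)
  have hsum : ∑ d, τ d =
      complexGysin complexOrientationFamily hX (Motives.IsSmoothProjective.tensor_holds hW hX)
        (lift g (𝟙 X)) (show 0 + 2 * (m + n) = 2 * m + 2 * n by omega)
        (singularCohomology.one ℂ (ComplexPoints X)) := by
    calc ∑ d, τ d
        = ∑ d, complexBetti.map (lift (snd W X) (fst W X)) (2 * m) (ρ (Fin.revPerm d)) := by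
          simp only [τ, Fin.revPerm_apply]
      _ = ∑ i, complexBetti.map (lift (snd W X) (fst W X)) (2 * m) (ρ i) :=
          Equiv.sum_comp Fin.revPerm (fun i ↦ complexBetti.map (lift (snd W X) (fst W X)) (2 * m) (ρ i))
      _ = complexBetti.map (lift (snd W X) (fst W X)) (2 * m) (∑ i, ρ i) := by rw [map_sum]
      _ = _ := by rw [hΓ, complexBetti_map_swap_complexGysin_lift_one hX hX hW (𝟙 X) g rfl]
  -- so `τ` is THE Künneth decomposition of `[Γ_g]`, with algebraic members
  have halg : τ (Fin.rev i) ∈ algebraicClasses (W ⊗ X) m :=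
    kunnethComponent_graphClass_mem_algebraicClasses_of_forall hX hW g hmn hCX hτ hsum (Fin.rev i)
  have hτi : τ (Fin.rev i) = complexBetti.map (lift (snd W X) (fst W X)) (2 * m) (ρ i) := by
    simp only [τ, Fin.rev_rev]
  rw [hτi] at halg
  let e : W ⊗ X ≅ X ⊗ W :=
    ⟨lift (snd W X) (fst W X), lift (snd X W) (fst X W), swap_comp_swap W X, swap_comp_swap X W⟩
  exact (mem_algebraicClasses_map_iff_of_iso e).1 halg

end Literature.AlgebraicGeometry.HodgeTheory

end
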